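import Literature.Topology.FourManifolds.ConcordanceStripTubeGeometry
import Literature.Topology.FourManifolds.SphereIsometryDiffeotopy
import Literature.Topology.FourManifolds.KnotFlatArc
import Literature.Topology.FourManifolds.NullImages
import Mathlib.MeasureTheory.Measure.Haar.InnerProductSpace
import HarnessLib

/-!
# Rotating a conical concordance off the south pole

Topic `Literature/Topology/FourManifolds`; preparatory step of the proof programme of the
Fox–Milnor fact `Literature.Topology.FourManifolds.Knot.exists_isConnectedSum_isConcordant`
(the concordances are read in the stereographic chart from the south pole,
`LongAnnulusChart.lean`). Everything here is proved; no named fact is introduced.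

* `Knot.IsConcordance.comp_linearIsometry`, `Knot.IsConicalConcordance.comp_linearIsometry` — a
  linear isometry `J` of `ℝ⁴` carries a (conical) concordance from `K` to `K'` to one from
  `J ∘ K` to `J ∘ K'` (`SphereEmbedding.map (sphereCongr J)`).
* `Knot.IsConicalConcordance.exists_unit_notMem_directions` — **a generic direction**: a unit
  vector `q ≠ southPole` which is not the direction `f / ‖f‖` of any point of the concordance over
  `[1, 2]` (the cone `{r • f (x, t)}` over the annulus is the `C¹` image of a `3`-dimensional
  space, a null set of `ℝ⁴`, `NullImages.lean`).
* `Knot.IsConicalConcordance.exists_offPole` — **composing with the rotation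
  `ρ_{e₀} ∘ ρ_{q - southPole}`** (two hyperplane reflections, diffeotopic to the identity by
  `Diffeomorph.isDiffeotopicToId_sphereCongr_reflection_trans`, hence moving knots within their
  isotopy classes) yields a conical concordance between isotopic knots all of whose directions over
  `[1, 2]`, and whose end knots, miss the south pole.

## References

* M. W. Hirsch, *Differential Topology*, GTM 33 (1976), Ch. 3 §1 (null sets), Ch. 8 §1.
  [HirschDT1976]

## Design notes

No named facts, no `sorry`; `𝔼 n`, `𝕊 n` are local notation as in `Knots.lean`.
-/

open scoped Manifold Topology ContDiff RealInnerProductSpace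
open Function Set Metric Filter MeasureTheory Module

noncomputable section

namespace Literature.Topology.FourManifolds

/-- Local notation: `𝔼 n` is the model Euclidean space `EuclideanSpace ℝ (Fin n)`. -/
local notation "𝔼 " n:arg => EuclideanSpace ℝ (Fin n)

/-- Local notation: `𝕊 n` is the unit sphere in `EuclideanSpace ℝ (Fin (n + 1))`. -/
local notation "𝕊 " n:arg => (Metric.sphere (0 : EuclideanSpace ℝ (Fin (n + 1))) 1)

attribute [local instance] fact_finrank_euclideanSpace_succ

namespace Knot

open KnotsInBall StripFrame

/-! ### Linear isometries carry concordances -/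

/-- **A linear isometry of `ℝ⁴` carries a concordance from `K` to `K'` to a concordance from
`J ∘ K` to `J ∘ K'`.** [folklore] -/
theorem IsConcordance.comp_linearIsometry {K K' : Knot} {f : (𝕊 1) × ℝ → 𝔼 4}
    (hf : IsConcordance K K' f) (J : 𝔼 4 ≃ₗᵢ[ℝ] 𝔼 4) :
    IsConcordance (K.map (sphereCongr J)) (K'.map (sphereCongr J)) ((J : 𝔼 4 → 𝔼 4) ∘ f) := by
  obtain ⟨hs, hinj, himm, hshell, hneat, h₁, h₂⟩ := hf
  have hJs : ContMDiff 𝓘(ℝ, 𝔼 4) 𝓘(ℝ, 𝔼 4) ∞ (J : 𝔼 4 → 𝔼 4) := J.contDiff.contMDiff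
  refine ⟨hJs.comp hs, J.injective.comp_injOn hinj, ?_, ?_, ?_, ?_, ?_⟩
  · intro p hp
    have hfd : MDifferentiableAt ((𝓡 1).prod 𝓘(ℝ, ℝ)) 𝓘(ℝ, 𝔼 4) f p := hs.mdifferentiableAt (by simp)
    have hJd : HasMFDerivAt 𝓘(ℝ, 𝔼 4) 𝓘(ℝ, 𝔼 4) (J : 𝔼 4 → 𝔼 4) (f p)
        (J.toContinuousLinearEquiv : 𝔼 4 →L[ℝ] 𝔼 4) :=
      (J.toContinuousLinearEquiv : 𝔼 4 →L[ℝ] 𝔼 4).hasMFDerivAt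
    rw [(hJd.comp p hfd.hasMFDerivAt).mfderiv]
    exact J.injective.comp (himm p hp)
  · intro x t ht
    simp only [comp_apply, LinearIsometryEquiv.norm_map]
    exact hshell x t ht
  · intro x
    have : (fun t ↦ ‖((J : 𝔼 4 → 𝔼 4) ∘ f) (x, t)‖ ^ 2) = fun t ↦ ‖f (x, t)‖ ^ 2 := by
      funext t; simp only [comp_apply, LinearIsometryEquiv.norm_map]
    rw [this]; exact hneat x
  · intro x
    simp only [comp_apply, h₁ x, SphereEmbedding.coe_map, coe_sphereCongr]
  · intro x
    simp only [comp_apply, h₂ x, map_smul, SphereEmbedding.coe_map, coe_sphereCongr]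

/-- **A linear isometry of `ℝ⁴` carries a conical concordance to a conical concordance** of the
same width. [folklore] -/
theorem IsConicalConcordance.comp_linearIsometry {K K' : Knot} {f : (𝕊 1) × ℝ → 𝔼 4} {δ : ℝ}
    (h : IsConicalConcordance K K' f δ) (J : 𝔼 4 ≃ₗᵢ[ℝ] 𝔼 4) :
    IsConicalConcordance (K.map (sphereCongr J)) (K'.map (sphereCongr J)) ((J : 𝔼 4 → 𝔼 4) ∘ f) δ where
  isConcordance := h.isConcordance.comp_linearIsometry J
  δ_pos := h.δ_pos
  δ_le := h.δ_le
  cone₁ x t ht := by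
    simp only [comp_apply, h.cone₁ x t ht, map_smul, SphereEmbedding.coe_map, coe_sphereCongr]
  cone₂ x t ht := by
    simp only [comp_apply, h.cone₂ x t ht, map_smul, SphereEmbedding.coe_map, coe_sphereCongr]

/-! ### A generic direction -/

namespace IsConicalConcordance

variable {K K' : Knot} {f : (𝕊 1) × ℝ → 𝔼 4} {δ : ℝ} (h : IsConicalConcordance K K' f δ)
include h

/-- Over `[1, 2]` the lift does not vanish. [folklore] -/
theorem annulusLift_ne_zero {θ t : ℝ} (ht : t ∈ Icc (1 : ℝ) 2) : annulusLift f (θ, t) ≠ 0 := by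
  have hδ := h.δ_pos
  intro h0
  rcases lt_or_ge t 2 with h2 | h2
  · rcases eq_or_lt_of_le ht.1 with h1 | h1
    · rw [← h1, annulusLift_apply, h.cone₁ _ 1 (by linarith), one_smul] at h0
      exact ne_zero_of_mem_unit_sphere _ h0
    · have := (h.isConcordance.2.2.2.1 (circlePt θ) t ⟨h1, h2⟩).1
      rw [annulusLift_apply] at h0; rw [h0, norm_zero] at this; linarith
  · rw [annulusLift_apply, h.cone₂ _ t (by linarith), smul_eq_zero] at h0
    rcases h0 with h0 | h0
    · linarith
    · exact ne_zero_of_mem_unit_sphere _ h0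

/-- **A generic direction**: a unit vector `q ≠ southPole` which is the direction of no point of
the concordance over `[1, 2]` (the cone over the annulus and the axis of the pole are null sets
of `ℝ⁴`). [folklore] -/
theorem exists_unit_notMem_directions :
    ∃ q : 𝔼 4, ‖q‖ = 1 ∧ q ≠ ((southPole : 𝕊 3) : 𝔼 4) ∧
      ∀ θ, ∀ t ∈ Icc (1 : ℝ) 2, ‖annulusLift f (θ, t)‖⁻¹ • annulusLift f (θ, t) ≠ q := by
  -- the two null sets
  set g : ℝ × ℝ × ℝ → 𝔼 4 := fun z ↦ z.2.2 • annulusLift f (z.1, z.2.1) with hg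
  have hgs : ContDiff ℝ ∞ g :=
    (contDiff_snd.comp contDiff_snd).smul ((contDiff_annulusLift h.isConcordance.1).comp
      (contDiff_fst.prodMk (contDiff_fst.comp contDiff_snd)))
  set ℓ : ℝ → 𝔼 4 := fun r ↦ r • ((southPole : 𝕊 3) : 𝔼 4) with hℓ
  have hℓs : ContDiff ℝ ∞ ℓ := contDiff_id.smul contDiff_const
  have hμ : (volume : Measure (𝔼 4)) (g '' univ ∪ ℓ '' univ) = 0 := by
    refine measure_union_null ?_ ?_
    · refine addHaar_image_eq_zero_of_finrank_lt volume ?_ (hgs.differentiable (by simp)).differentiableOn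
      simp [finrank_prod]
    · refine addHaar_image_eq_zero_of_finrank_lt volume ?_ (hℓs.differentiable (by simp)).differentiableOn
      simp
  obtain ⟨y, -, hy⟩ := exists_mem_notMem_of_measure_zero volume isOpen_univ univ_nonempty hμ
  rw [mem_union, not_or] at hy
  obtain ⟨hyg, hyℓ⟩ := hy
  have hy0 : y ≠ 0 := by
    intro h0; apply hyg; exact ⟨(0, 1, 0), mem_univ _, by simp [hg, h0]⟩
  have hyn : ‖y‖ ≠ 0 := norm_ne_zero_iff.2 hy0
  refine ⟨‖y‖⁻¹ • y, by rw [norm_smul, norm_inv, norm_norm, inv_mul_cancel₀ hyn], ?_, ?_⟩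
  · intro heq
    apply hyℓ
    refine ⟨‖y‖, mem_univ _, ?_⟩
    simp only [hℓ, ← heq, smul_smul, mul_inv_cancel₀ hyn, one_smul]
  · intro θ t ht heq
    have hL := h.annulusLift_ne_zero (θ := θ) ht
    have hLn : ‖annulusLift f (θ, t)‖ ≠ 0 := norm_ne_zero_iff.2 hL
    apply hyg
    refine ⟨(θ, t, ‖y‖ * ‖annulusLift f (θ, t)‖⁻¹), mem_univ _, ?_⟩
    simp only [hg]
    rw [mul_smul, heq, smul_smul, mul_inv_cancel₀ hyn, one_smul]

/-! ### Rotating off the pole -/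

/-- **Rotating a conical concordance off the south pole.** For every conical concordance `f`
from `K` to `K'` there is a diffeomorphism `φ` of `𝕊³`, diffeotopic to the identity and given by
a linear isometry `J` of `ℝ⁴` (a product of two hyperplane reflections), such that `J ∘ f` is a
conical concordance of the same width between the isotopic knots `φ ∘ K`, `φ ∘ K'`, whose end
knots and whose directions over `[1, 2]` all miss the south pole. [folklore] -/
theorem exists_offPole :
    ∃ (φ : (𝕊 3) ≃ₘ⟮𝓡 3, 𝓡 3⟯ (𝕊 3)) (J : 𝔼 4 ≃ₗᵢ[ℝ] 𝔼 4),
      Diffeomorph.IsDiffeotopicToId φ ∧ (∀ y : 𝕊 3, ((φ y : 𝕊 3) : 𝔼 4) = J y) ∧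
      K.IsIsotopic (K.map φ) ∧ K'.IsIsotopic (K'.map φ) ∧
      IsConicalConcordance (K.map φ) (K'.map φ) ((J : 𝔼 4 → 𝔼 4) ∘ f) δ ∧
      (∀ x, (K.map φ) x ≠ southPole) ∧ (∀ x, (K'.map φ) x ≠ southPole) ∧
      ∀ θ, ∀ t ∈ Icc (1 : ℝ) 2,
        ‖annulusLift ((J : 𝔼 4 → 𝔼 4) ∘ f) (θ, t)‖⁻¹ • annulusLift ((J : 𝔼 4 → 𝔼 4) ∘ f) (θ, t) ≠
          ((southPole : 𝕊 3) : 𝔼 4) := by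
  obtain ⟨q, hq1, hqS, hqdir⟩ := h.exists_unit_notMem_directions
  set S : 𝔼 4 := ((southPole : 𝕊 3) : 𝔼 4) with hS
  have hS1 : ‖S‖ = 1 := norm_eq_of_mem_sphere _
  set e₀ : 𝔼 4 := EuclideanSpace.single 0 1 with he₀
  have he₀0 : e₀ ≠ 0 := by
    intro h0; have := congrArg (fun v : 𝔼 4 ↦ v 0) h0; simp [he₀] at this
  have hqS0 : q - S ≠ 0 := sub_ne_zero.2 hqS
  -- the two reflections
  set ρ₁ : 𝔼 4 ≃ₗᵢ[ℝ] 𝔼 4 := (ℝ ∙ (q - S))ᗮ.reflection with hρ₁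
  set ρ₂ : 𝔼 4 ≃ₗᵢ[ℝ] 𝔼 4 := (ℝ ∙ e₀)ᗮ.reflection with hρ₂
  have hρ₁q : ρ₁ q = S := Submodule.reflection_sub (by rw [hq1, hS1])
  have hρ₂S : ρ₂ S = S := by
    apply Submodule.reflection_mem_subspace_eq_self
    rw [Submodule.mem_orthogonal_singleton_iff_inner_right]
    simp [he₀, hS, KnotsInBall.coe_southPole, EuclideanSpace.inner_single_left]
  set J : 𝔼 4 ≃ₗᵢ[ℝ] 𝔼 4 := ρ₁.trans ρ₂ with hJ
  have hJq : J q = S := by simp only [hJ, LinearIsometryEquiv.trans_apply, hρ₁q, hρ₂S]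
  set φ : (𝕊 3) ≃ₘ⟮𝓡 3, 𝓡 3⟯ (𝕊 3) := (sphereCongr (n := 3) ρ₁).trans (sphereCongr ρ₂) with hφ
  have hφJ : ∀ y : 𝕊 3, ((φ y : 𝕊 3) : 𝔼 4) = J y := fun y ↦ by
    simp only [hφ, hJ, Diffeomorph.coe_trans, comp_apply, coe_sphereCongr, LinearIsometryEquiv.trans_apply]
  have hφeq : φ = sphereCongr J := Diffeomorph.ext fun y ↦ Subtype.ext (by rw [hφJ, coe_sphereCongr])
  have hiso : Diffeomorph.IsDiffeotopicToId φ :=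
    Diffeomorph.isDiffeotopicToId_sphereCongr_reflection_trans hqS0 he₀0
  have hcc : IsConicalConcordance (K.map φ) (K'.map φ) ((J : 𝔼 4 → 𝔼 4) ∘ f) δ := by
    rw [hφeq]; exact h.comp_linearIsometry J
  -- directions after the rotation
  have hne : ∀ v : 𝔼 4, ‖v‖⁻¹ • v ≠ q → ‖J v‖⁻¹ • J v ≠ S := by
    intro v hvq heq
    apply hvq
    apply J.injective
    rw [map_smul, hJq]
    rwa [LinearIsometryEquiv.norm_map] at heq
  have hKq : ∀ x, ((K x : 𝕊 3) : 𝔼 4) ≠ q := by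
    intro x
    have hx : circlePt (angA x) = x := circlePt_angA x
    have hv : annulusLift f (angA x, 1) = ((K x : 𝕊 3) : 𝔼 4) := by
      rw [annulusLift_apply, h.cone₁ _ 1 (by linarith [h.δ_pos]), one_smul, hx]
    have := hqdir (angA x) 1 ⟨le_rfl, by norm_num⟩
    rwa [hv, norm_eq_of_mem_sphere, inv_one, one_smul] at this
  have hK'q : ∀ x, ((K' x : 𝕊 3) : 𝔼 4) ≠ q := by
    intro x
    have hx : circlePt (angA x) = x := circlePt_angA x
    have hv : annulusLift f (angA x, 2) = (2 : ℝ) • ((K' x : 𝕊 3) : 𝔼 4) := by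
      rw [annulusLift_apply, h.cone₂ _ 2 (by linarith [h.δ_pos]), hx]
    have := hqdir (angA x) 2 ⟨by norm_num, le_rfl⟩
    rwa [hv, norm_smul, norm_eq_of_mem_sphere, mul_one, Real.norm_eq_abs, abs_of_pos two_pos,
      smul_smul, inv_mul_cancel₀ two_ne_zero, one_smul] at this
  have hmapK : ∀ (L : Knot) (x : 𝕊 1), (((L.map φ) x : 𝕊 3) : 𝔼 4) = J (L x) := fun L x ↦ hφJ (L x)
  refine ⟨φ, J, hiso, hφJ, K.isIsotopic_map_of_isDiffeotopicToId hiso,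
    K'.isIsotopic_map_of_isDiffeotopicToId hiso, hcc, ?_, ?_, ?_⟩
  · intro x heq
    have h1 : J ((K x : 𝕊 3) : 𝔼 4) = S := by rw [← hmapK K x, heq]
    exact hKq x (J.injective (h1.trans hJq.symm))
  · intro x heq
    have h1 : J ((K' x : 𝕊 3) : 𝔼 4) = S := by rw [← hmapK K' x, heq]
    exact hK'q x (J.injective (h1.trans hJq.symm))
  · intro θ t ht
    exact hne _ (hqdir θ t ht)

end IsConicalConcordance

end Knot

end Literature.Topology.FourManifolds
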